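import Literature.Probability.RandomPlanarGeometry.HexSAWHexagonHeights
import HarnessLib

/-!
# Hexagon surgery restricted to half-space walks of the honeycomb lattice (brick-wall heights)

Topic `Literature/Probability/RandomPlanarGeometry` (self-avoiding walks on `ℍ` in the `HV` model; add-on to
`HexSAWHexagonSurgery.lean` and `HexSAWHexagonHeights.lean`). Lane «pcv-sawmu», door R79 «HEX-HALFSPACE-RATIO-2»
(`h_{N+2}(ℍ)/h_N(ℍ) → 2+√2` for brick-wall half-space walks), piece H1.

Source of the method: N. Madras, G. Slade, *The Self-Avoiding Walk* (1993), Definition 3.1.2, p. 58 (half-space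
walks: `ω₁(0) < ω₁(i)` for `1 ≤ i ≤ N`), §7.3, proof of Theorem 7.3.2, p. 245 (pair counting (7.3.5)–(7.3.7),
with the `U/V` surgery performed inside a sub-class `W_N` of walks: (a) all walks, (b) bridges, (c) fixed endpoint —
the half-space class is our analogue); G. Lawler, O. Schramm, W. Werner (2004), (A.3) (`h_{N+1}/h_N → μ` on `ℤ^d`,
hence `h_{N+2}/h_N → μ²`). Here the height is the brick-wall coordinate `h(v) = hvToBW v 0 = v.1 − v.2.1` of
`SAWBrickWallHex.lean`, and a HALF-SPACE WALK is an `HV` vertex list `ω ∈ S_N(ℍ)` with `h(ω_0) < h(ω_j)` for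
`1 ≤ j ≤ N` (the image of M–S's definition under `bwIso`; the identification of `#(hexHalfFin N)` with the brick-wall
count `HexBW.halfSpaceCount N` is proved in the lane's K79 file, not here).

The hexagon surgery of `HexSAWHexagonSurgery.lean` is restricted as follows: insertion slots `(m, x, y, z)` are
ADMISSIBLE when `x, y, z` lie strictly above the base height `h(ω_0)`; deletion sites `(m, v)` are counted when `v`
lies strictly above the base (every site with `m ≥ 1` does, by `HexSAWHexagonHeights`; only the run through `ω_0`
can free a vertex at the base height). Then insertion/deletion preserve half-space walks, the pair bijection
restricts, and the bookkeeping constants survive (`J_H ≤ J_H' + 27`, `J_H' ≤ J_H + 27` via `J_H ≤ J ≤ J_H + 3`;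
`I_H ≤ I_H' + 324` by the shift injection of the base file, restricted).

## Contents (namespace `Literature.Probability.RandomPlanarGeometry.SAW.HV`)
* `Above ω v`, `hexHalfFin N`, `hexSlotsH ω`, `hexSharpH ω` (+ membership lemmas);
* `hexIns_mem_hexHalfFin`, `mem_hexSharpH_hexIns`, `hexDel_mem_hexHalfFin`, `mem_hexSlotsH_hexDel`;
* `hexSlotPairsH`, `hexSharpPairsH`, `sum_hexSlotPairsH`, `sum_hexSharpPairsH`,
  **`sum_hexSlotPairsH_eq_sum_hexSharpPairsH`**;
* `card_hexSharp_le_card_hexSharpH_add_three` (`J ≤ J_H + 3` on half-space walks), `one_le_card_hexSharpH_hexIns`,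
  `card_hexSharpH_le_hexIns` (`J_H ≤ J_H' + 27`), `card_hexSharpH_hexIns_le` (`J_H' ≤ J_H + 27`),
  `card_hexSlotsH_le_hexIns` (`I_H ≤ I_H' + 324`), `card_hexSlotsH_le` (`I_H ≤ 27(|ω| − 2)`).
-/

noncomputable section

open Finset
open Literature.Probability.LatticeModels Literature.Probability.Percolation SimpleGraph

namespace Literature.Probability.RandomPlanarGeometry.SAW.HV

/-! ### The band, bridges, admissible slots, band deletion sites -/

/-- «Strictly above the base»: `h(ω_0) < h(v)`, `h = hvToBW · 0` (the half-space condition of a vertex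
relative to the start of the list `ω`). [cite: MadrasSlade1993, Definition 3.1.2, p. 58] -/
def Above (ω : List HV) (v : HV) : Prop := hvToBW (ω.getD 0 hvOrigin) 0 < hvToBW v 0

/-- `Above` is decidable (an integer comparison). [folklore] -/
instance instDecidableAbove (ω : List HV) (v : HV) : Decidable (Above ω v) := by
  unfold Above; infer_instance

/-- **Half-space walks of `ℍ` in the brick-wall frame**, as `HV` vertex lists: `N`-step self-avoiding walks from
the origin with `h(ω_0) < h(ω_j)` for `1 ≤ j ≤ N`. [cite: MadrasSlade1993, Definition 3.1.2, p. 58] -/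
def hexHalfFin (N : ℕ) : Finset (List HV) :=
  (sawFin hvOrigin N).filter fun ω => ∀ j < N + 1, 1 ≤ j → Above ω (ω.getD j hvOrigin)

/-- **Admissible insertion slots** of a walk: hexagon slots whose three new vertices lie strictly above the base.
[cite: MadrasSlade1993, §7.3, proof of Theorem 7.3.2, p. 245 (surgery inside a sub-class W_N; the half-space class is our analogue)] -/
def hexSlotsH (ω : List HV) : Finset (ℕ × HV × HV × HV) :=
  (hexSlots ω).filter fun s => Above ω s.2.1 ∧ Above ω s.2.2.1 ∧ Above ω s.2.2.2

/-- **Counted deletion sites** of a walk: hexagon deletion sites whose freed vertex lies strictly above the base.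
[cite: MadrasSlade1993, §7.3, proof of Theorem 7.3.2, p. 245 (surgery inside a sub-class W_N; the half-space class is our analogue)] -/
def hexSharpH (ω : List HV) : Finset (ℕ × HV) := (hexSharp ω).filter fun p => Above ω p.2

section Mem

variable {N : ℕ} {ω : List HV} {m : ℕ} {x y z v : HV}

/-- Membership in `hexHalfFin`. [cite: MadrasSlade1993, Definition 3.1.2, p. 58] -/
theorem mem_hexHalfFin : ω ∈ hexHalfFin N ↔
    ω ∈ sawFin hvOrigin N ∧ ∀ j, 1 ≤ j → j ≤ N → Above ω (ω.getD j hvOrigin) := by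
  rw [hexHalfFin, mem_filter]
  exact and_congr_right fun _ =>
    ⟨fun h j h1 h2 => h j (by omega) h1, fun h j hj h1 => h j h1 (by omega)⟩

/-- A half-space walk is a walk of `S_N(ℍ)`. [cite: MadrasSlade1993, Definition 3.1.2, p. 58] -/
theorem mem_sawFin_of_mem_hexHalfFin (h : ω ∈ hexHalfFin N) : ω ∈ sawFin hvOrigin N := (mem_hexHalfFin.1 h).1

/-- Membership in `hexSlotsH`. [cite: MadrasSlade1993, §7.3] -/
theorem mem_hexSlotsH : (m, x, y, z) ∈ hexSlotsH ω ↔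
    (m, x, y, z) ∈ hexSlots ω ∧ Above ω x ∧ Above ω y ∧ Above ω z := by
  rw [hexSlotsH, mem_filter]

/-- Membership in `hexSharpH`. [cite: MadrasSlade1993, §7.3] -/
theorem mem_hexSharpH : (m, v) ∈ hexSharpH ω ↔ (m, v) ∈ hexSharp ω ∧ Above ω v := by
  rw [hexSharpH, mem_filter]

/-- `hexSlotsH ⊆ hexSlots`. [cite: MadrasSlade1993, §7.3] -/
theorem hexSlotsH_subset : hexSlotsH ω ⊆ hexSlots ω := filter_subset _ _

/-- `hexSharpH ⊆ hexSharp`. [cite: MadrasSlade1993, §7.3] -/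
theorem hexSharpH_subset : hexSharpH ω ⊆ hexSharp ω := filter_subset _ _

/-- `I_H(ω) ≤ 27(|ω| − 2)`. [cite: MadrasSlade1993, §7.3] -/
theorem card_hexSlotsH_le : #(hexSlotsH ω) ≤ 27 * (ω.length - 2) :=
  (card_le_card hexSlotsH_subset).trans card_hexSlots_le

/-- `Above` only depends on the first vertex. [folklore] -/
private theorem above_congr {ω ω' : List HV} (h0 : ω'.getD 0 hvOrigin = ω.getD 0 hvOrigin) : Above ω' v ↔ Above ω v := by
  rw [Above, Above, h0]

end Mem

/-! ### Insertion and deletion keep the first vertex, hence `Above` -/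

section Base

variable {N : ℕ} {ω : List HV} {m : ℕ} {x y z v : HV}

/-- `hexIns` keeps the first vertex. [cite: MadrasSlade1993, §7.3 (proof of Theorem 7.3.2)] -/
theorem getD_hexIns_zero (hm : m + 1 ≤ ω.length) : (hexIns m x y z ω).getD 0 hvOrigin = ω.getD 0 hvOrigin :=
  getD_hexIns_of_le hm (Nat.zero_le _)

/-- `hexDel` keeps the first vertex. [cite: MadrasSlade1993, §7.3 (proof of Theorem 7.3.2)] -/
theorem getD_hexDel_zero (hm : m + 1 ≤ ω.length) : (hexDel m v ω).getD 0 hvOrigin = ω.getD 0 hvOrigin :=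
  getD_hexDel_of_le hm (Nat.zero_le _)

/-- `Above` after an insertion is `Above` before. [cite: MadrasSlade1993, §7.3] -/
theorem above_hexIns_iff (hm : m + 2 < ω.length) : Above (hexIns m x y z ω) v ↔ Above ω v :=
  above_congr (getD_hexIns_zero (by omega))

/-- `Above` after a deletion is `Above` before. [cite: MadrasSlade1993, §7.3] -/
theorem above_hexDel_iff {w : HV} (hm : m + 4 < ω.length) : Above (hexDel m v ω) w ↔ Above ω w :=
  above_congr (getD_hexDel_zero (by omega))

end Base

/-! ### The restricted surgery laws -/

section Surgery

variable {N : ℕ} {ω : List HV} {m : ℕ} {x y z v : HV}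

/-- Hexagon insertion at an ADMISSIBLE slot of a half-space walk gives a half-space walk (two steps longer).
[cite: MadrasSlade1993, §7.3, proof of Theorem 7.3.2, p. 245 (surgery inside a sub-class W_N; the half-space class is our analogue)] -/
theorem hexIns_mem_hexHalfFin (hω : ω ∈ hexHalfFin N) (hs : (m, x, y, z) ∈ hexSlotsH ω) :
    hexIns m x y z ω ∈ hexHalfFin (N + 2) := by
  obtain ⟨hω', hband⟩ := mem_hexHalfFin.1 hω
  obtain ⟨hs', hx, hy, hz⟩ := mem_hexSlotsH.1 hs
  obtain ⟨hm, -⟩ := mem_hexSlots.1 hs'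
  have hl := length_of_mem_sawFin hω'
  refine mem_hexHalfFin.2 ⟨hexIns_mem_sawFin hω' hs', fun j hj1 hj2 => ?_⟩
  rw [above_hexIns_iff hm]
  rcases Nat.lt_or_ge j (m + 1) with h1 | h1
  · rw [getD_hexIns_of_le (by omega) (by omega)]; exact hband j hj1 (by omega)
  rcases Nat.lt_or_ge j (m + 2) with h2 | h2
  · obtain rfl : j = m + 1 := by omega
    rw [getD_hexIns_one (by omega)]; exact hx
  rcases Nat.lt_or_ge j (m + 3) with h3 | h3
  · obtain rfl : j = m + 2 := by omega
    rw [getD_hexIns_two (by omega)]; exact hy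
  rcases Nat.lt_or_ge j (m + 4) with h4 | h4
  · obtain rfl : j = m + 3 := by omega
    rw [getD_hexIns_three (by omega)]; exact hz
  · rw [getD_hexIns_of_ge (by omega) h4]; exact hband (j - 2) (by omega) (by omega)

/-- After an admissible insertion into a half-space walk, the removed vertex marks a counted deletion site.
[cite: MadrasSlade1993, §7.3, proof of Theorem 7.3.2, p. 245 (surgery inside a sub-class W_N; the half-space class is our analogue)] -/
theorem mem_hexSharpH_hexIns (hω : ω ∈ hexHalfFin N) (hs : (m, x, y, z) ∈ hexSlotsH ω) :
    (m, ω.getD (m + 1) hvOrigin) ∈ hexSharpH (hexIns m x y z ω) := by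
  obtain ⟨hω', hband⟩ := mem_hexHalfFin.1 hω
  obtain ⟨hs', -, -, -⟩ := mem_hexSlotsH.1 hs
  obtain ⟨hm, -⟩ := mem_hexSlots.1 hs'
  have hl := length_of_mem_sawFin hω'
  refine mem_hexSharpH.2 ⟨mem_hexSharp_hexIns hω' hs', ?_⟩
  rw [above_hexIns_iff hm]
  exact hband (m + 1) (by omega) (by omega)

/-- Hexagon deletion at a counted site of a half-space walk gives a half-space walk (two steps shorter).
[cite: MadrasSlade1993, §7.3, proof of Theorem 7.3.2, p. 245 (surgery inside a sub-class W_N; the half-space class is our analogue)] -/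
theorem hexDel_mem_hexHalfFin (hω : ω ∈ hexHalfFin (N + 2)) (hm : (m, v) ∈ hexSharpH ω) :
    hexDel m v ω ∈ hexHalfFin N := by
  obtain ⟨hω', hband⟩ := mem_hexHalfFin.1 hω
  obtain ⟨hm', hv⟩ := mem_hexSharpH.1 hm
  obtain ⟨hml, -⟩ := mem_hexSharp.1 hm'
  have hl := length_of_mem_sawFin hω'
  refine mem_hexHalfFin.2 ⟨hexDel_mem_sawFin hω' hm', fun j hj1 hj2 => ?_⟩
  rw [above_hexDel_iff hml]
  rcases Nat.lt_or_ge j (m + 1) with h1 | h1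
  · rw [getD_hexDel_of_le (by omega) (by omega)]; exact hband j hj1 (by omega)
  rcases Nat.lt_or_ge j (m + 2) with h2 | h2
  · obtain rfl : j = m + 1 := by omega
    rw [getD_hexDel_one (by omega)]; exact hv
  · rw [getD_hexDel_of_ge (by omega) h2]; exact hband (j + 2) (by omega) (by omega)

/-- After a counted deletion from a half-space walk, the three removed vertices form an ADMISSIBLE slot.
[cite: MadrasSlade1993, §7.3, proof of Theorem 7.3.2, p. 245 (surgery inside a sub-class W_N; the half-space class is our analogue)] -/
theorem mem_hexSlotsH_hexDel (hω : ω ∈ hexHalfFin (N + 2)) (hm : (m, v) ∈ hexSharpH ω) :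
    (m, ω.getD (m + 1) hvOrigin, ω.getD (m + 2) hvOrigin, ω.getD (m + 3) hvOrigin) ∈ hexSlotsH (hexDel m v ω) := by
  obtain ⟨hω', hband⟩ := mem_hexHalfFin.1 hω
  obtain ⟨hm', -⟩ := mem_hexSharpH.1 hm
  obtain ⟨hml, -⟩ := mem_hexSharp.1 hm'
  have hl := length_of_mem_sawFin hω'
  refine mem_hexSlotsH.2 ⟨mem_hexSlots_hexDel hω' hm', ?_, ?_, ?_⟩ <;> rw [above_hexDel_iff hml]
  · exact hband (m + 1) (by omega) (by omega)
  · exact hband (m + 2) (by omega) (by omega)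
  · exact hband (m + 3) (by omega) (by omega)

end Surgery

/-! ### Counting the restricted pairs in two ways -/

section Pairs

/-- The admissible slot pairs `(ω, s)`, `ω` a half-space walk of `H_N(ℍ)`. [cite: MadrasSlade1993, §7.3 (7.3.5)] -/
def hexSlotPairsH (N : ℕ) : Finset (Σ _ : List HV, ℕ × HV × HV × HV) :=
  (hexHalfFin N).sigma fun ω => hexSlotsH ω

/-- The counted deletion-site pairs `(ω, (m, v))`, `ω` a half-space walk of `H_N(ℍ)`. [cite: MadrasSlade1993, §7.3 (7.3.5)] -/
def hexSharpPairsH (N : ℕ) : Finset (Σ _ : List HV, ℕ × HV) := (hexHalfFin N).sigma fun ω => hexSharpH ω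

/-- Summing over admissible slot pairs is summing `I_H(ω) · F(ω)` over half-space walks. [cite: MadrasSlade1993, §7.3] -/
theorem sum_hexSlotPairsH (N : ℕ) (F : List HV → ℝ) :
    ∑ p ∈ hexSlotPairsH N, F p.1 = ∑ ω ∈ hexHalfFin N, (#(hexSlotsH ω) : ℝ) * F ω := by
  rw [hexSlotPairsH, Finset.sum_sigma]
  refine sum_congr rfl fun ω _ => ?_
  change ∑ s ∈ hexSlotsH ω, F ω = _
  rw [sum_const, nsmul_eq_mul]

/-- Summing over counted deletion-site pairs is summing `J_H(ω) · F(ω)` over half-space walks. [cite: MadrasSlade1993, §7.3] -/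
theorem sum_hexSharpPairsH (N : ℕ) (F : List HV → ℝ) :
    ∑ q ∈ hexSharpPairsH N, F q.1 = ∑ ω ∈ hexHalfFin N, (#(hexSharpH ω) : ℝ) * F ω := by
  rw [hexSharpPairsH, Finset.sum_sigma]
  refine sum_congr rfl fun ω _ => ?_
  change ∑ s ∈ hexSharpH ω, F ω = _
  rw [sum_const, nsmul_eq_mul]

/-- **Counting the admissible pairs in two ways**: `(ω, (m, x, y, z)) ↦ (hexIns m x y z ω, (m, ω_{m+1}))` is a
bijection from the admissible slot pairs of `H_N(ℍ)` onto the counted deletion-site pairs of `H_{N+2}(ℍ)`.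
[cite: MadrasSlade1993, §7.3, proof of Theorem 7.3.2, (7.3.5) p. 245 – (7.3.6) p. 246 (inside a sub-class W_N)] -/
theorem sum_hexSlotPairsH_eq_sum_hexSharpPairsH (N : ℕ) (F : (Σ _ : List HV, ℕ × HV × HV × HV) → ℝ)
    (G : (Σ _ : List HV, ℕ × HV) → ℝ)
    (h : ∀ p ∈ hexSlotPairsH N,
      F p = G ⟨hexIns p.2.1 p.2.2.1 p.2.2.2.1 p.2.2.2.2 p.1, (p.2.1, p.1.getD (p.2.1 + 1) hvOrigin)⟩) :
    ∑ p ∈ hexSlotPairsH N, F p = ∑ q ∈ hexSharpPairsH (N + 2), G q := by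
  refine Finset.sum_nbij' (fun p => ⟨hexIns p.2.1 p.2.2.1 p.2.2.2.1 p.2.2.2.2 p.1, (p.2.1, p.1.getD (p.2.1 + 1) hvOrigin)⟩)
    (fun q => ⟨hexDel q.2.1 q.2.2 q.1,
      (q.2.1, q.1.getD (q.2.1 + 1) hvOrigin, q.1.getD (q.2.1 + 2) hvOrigin, q.1.getD (q.2.1 + 3) hvOrigin)⟩)
    ?_ ?_ ?_ ?_ h
  · rintro ⟨ω, m, x, y, z⟩ hp
    rw [hexSlotPairsH, Finset.mem_sigma] at hp
    rw [hexSharpPairsH, Finset.mem_sigma]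
    exact ⟨hexIns_mem_hexHalfFin hp.1 hp.2, mem_hexSharpH_hexIns hp.1 hp.2⟩
  · rintro ⟨ω, m, v⟩ hq
    rw [hexSharpPairsH, Finset.mem_sigma] at hq
    rw [hexSlotPairsH, Finset.mem_sigma]
    exact ⟨hexDel_mem_hexHalfFin hq.1 hq.2, mem_hexSlotsH_hexDel hq.1 hq.2⟩
  · rintro ⟨ω, m, x, y, z⟩ hp
    rw [hexSlotPairsH, Finset.mem_sigma] at hp
    dsimp only at hp
    obtain ⟨hm, -⟩ := mem_hexSlots.1 (mem_hexSlotsH.1 hp.2).1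
    dsimp only
    rw [hexDel_hexIns (by omega), getD_hexIns_one (by omega), getD_hexIns_two (by omega),
      getD_hexIns_three (by omega)]
  · rintro ⟨ω, m, v⟩ hq
    rw [hexSharpPairsH, Finset.mem_sigma] at hq
    dsimp only at hq
    obtain ⟨hml, -⟩ := mem_hexSharp.1 (mem_hexSharpH.1 hq.2).1
    dsimp only
    rw [hexIns_hexDel (by omega), getD_hexDel_one (by omega)]

end Pairs

/-! ### Bookkeeping: how the restricted surgery changes `I_H` and `J_H` -/

section Bookkeeping

variable {N : ℕ} {ω : List HV} {m : ℕ} {x y z : HV}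

/-- Membership in `hexNb` is adjacency. [folklore] -/
private theorem mem_hexNb' {u v : HV} : v ∈ hexNb u ↔ hvGraph.Adj u v := by
  rw [hexNb, List.mem_toFinset, hvGraph_adj_iff_mem_nbrs]

/-- A vertex of `ℍ` has at most three neighbours. [folklore] -/
private theorem card_hexNb_le' (u : HV) : #(hexNb u) ≤ 3 := by
  refine (List.toFinset_card_le _).trans ?_
  obtain ⟨a, b, c⟩ := u
  cases c <;> simp [nbrs]

/-- Membership in `hexChain3`. [folklore] -/
private theorem mem_hexChain3' {u x y z : HV} :
    (x, y, z) ∈ hexChain3 u ↔ hvGraph.Adj u x ∧ hvGraph.Adj x y ∧ hvGraph.Adj y z := by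
  simp only [hexChain3, mem_biUnion, mem_image, Prod.mk.injEq, mem_hexNb']
  constructor
  · rintro ⟨x', hx', y', hy', z', hz', rfl, rfl, rfl⟩
    exact ⟨hx', hy', hz'⟩
  · rintro ⟨hx, hy, hz⟩
    exact ⟨x, hx, y, hy, z, hz, rfl, rfl, rfl⟩

/-- There are at most `27` such chains. [folklore] -/
private theorem card_hexChain3_le' (u : HV) : #(hexChain3 u) ≤ 27 := by
  unfold hexChain3
  calc #((hexNb u).biUnion fun x => (hexNb x).biUnion fun y => (hexNb y).image fun z => (x, y, z))
      ≤ ∑ x ∈ hexNb u, #((hexNb x).biUnion fun y => (hexNb y).image fun z => (x, y, z)) := card_biUnion_le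
    _ ≤ ∑ x ∈ hexNb u, 9 := by
        refine sum_le_sum fun x _ => card_biUnion_le.trans ?_
        calc ∑ y ∈ hexNb x, #((hexNb y).image fun z => (x, y, z)) ≤ ∑ y ∈ hexNb x, 3 :=
              sum_le_sum fun y _ => card_image_le.trans (card_hexNb_le' y)
          _ ≤ 9 := by rw [sum_const, smul_eq_mul]; have := card_hexNb_le' x; omega
    _ ≤ 27 := by rw [sum_const, smul_eq_mul]; have := card_hexNb_le' u; omega

/-- The positions at which the walk visits a neighbour of `t`: at most `3`. [folklore] -/
private theorem card_filter_getD_adj_le' (hω : ω ∈ sawFin hvOrigin N) (t : HV) :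
    #((range (N + 1)).filter fun i => hvGraph.Adj t (ω.getD i hvOrigin)) ≤ 3 := by
  refine le_trans ?_ (card_hexNb_le' t)
  refine card_le_card_of_injOn (fun i => ω.getD i hvOrigin) (fun i hi => ?_) (fun i hi j hj e => ?_)
  · rw [mem_coe, mem_filter] at hi
    rw [mem_coe, mem_hexNb']
    exact hi.2
  · rw [mem_coe, mem_filter, mem_range] at hi hj
    exact getD_injOn_of_mem_sawFin hω hi.1 hj.1 e

/-- Deletion sites at a fixed position: at most `3`. [folklore] -/
private theorem card_hexSharp_filter_fst_eq_le' (ω : List HV) (j : ℕ) :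
    #((hexSharp ω).filter fun p => p.1 = j) ≤ 3 := by
  refine le_trans (card_le_card (t := (hexNb (ω.getD j hvOrigin)).image fun v => (j, v)) ?_)
    (card_image_le.trans (card_hexNb_le' (ω.getD j hvOrigin)))
  rintro ⟨j', v⟩ hp
  rw [mem_filter] at hp
  obtain ⟨hp, rfl⟩ := hp
  obtain ⟨-, h1, -, -⟩ := mem_hexSharp.1 hp
  exact mem_image.2 ⟨v, mem_hexNb'.2 h1, rfl⟩

/-- Slots at a fixed position: at most `27`. [folklore] -/
private theorem card_hexSlots_filter_fst_eq_le' (ω : List HV) (j : ℕ) :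
    #((hexSlots ω).filter fun s => s.1 = j) ≤ 27 := by
  refine le_trans (card_le_card (t := (hexChain3 (ω.getD j hvOrigin)).image fun c => (j, c)) ?_)
    (card_image_le.trans (card_hexChain3_le' (ω.getD j hvOrigin)))
  rintro ⟨j', x', y', z'⟩ hp
  rw [mem_filter] at hp
  obtain ⟨hp, rfl⟩ := hp
  obtain ⟨-, h1, h2, h3, -⟩ := mem_hexSlots.1 hp
  exact mem_image.2 ⟨(x', y', z'), mem_hexChain3'.2 ⟨h1, h2, h3⟩, rfl⟩

/-- Slots at positions in a window `[a, b]`: at most `27 (b + 1 − a)`. [folklore] -/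
private theorem card_hexSlots_filter_fst_mem_Icc_le' (ω : List HV) (a b : ℕ) :
    #((hexSlots ω).filter fun s => a ≤ s.1 ∧ s.1 ≤ b) ≤ 27 * (b + 1 - a) := by
  have hsub : ((hexSlots ω).filter fun s => a ≤ s.1 ∧ s.1 ≤ b) ⊆
      (Icc a b).biUnion fun j => (hexSlots ω).filter fun s => s.1 = j := by
    intro p hp
    rw [mem_filter] at hp
    exact mem_biUnion.2 ⟨p.1, mem_Icc.2 hp.2, mem_filter.2 ⟨hp.1, rfl⟩⟩
  refine (card_le_card hsub).trans (card_biUnion_le.trans ?_)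
  calc ∑ j ∈ Icc a b, #((hexSlots ω).filter fun s => s.1 = j) ≤ ∑ _j ∈ Icc a b, 27 :=
        sum_le_sum fun j _ => card_hexSlots_filter_fst_eq_le' ω j
    _ = 27 * (b + 1 - a) := by rw [sum_const, Nat.card_Icc, smul_eq_mul, mul_comm]

/-- Slots whose first new vertex is `t`: at most `27`. [folklore] -/
private theorem card_hexSlots_filter_x_eq_le' (hω : ω ∈ sawFin hvOrigin N) (t : HV) :
    #((hexSlots ω).filter fun s => s.2.1 = t) ≤ 27 := by
  have hl := length_of_mem_sawFin hω
  set P := (range (N + 1)).filter fun i => hvGraph.Adj t (ω.getD i hvOrigin) with hP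
  set T := (P ×ˢ ((hexNb t).biUnion fun y' => (hexNb y').image fun z' => (y', z'))).image
    fun q : ℕ × HV × HV => (q.1, t, q.2.1, q.2.2) with hT
  have hsub : ((hexSlots ω).filter fun s => s.2.1 = t) ⊆ T := by
    rintro ⟨i, x', y', z'⟩ hs
    rw [mem_filter] at hs
    obtain ⟨hs, rfl⟩ := hs
    obtain ⟨hi, h1, h2, h3, -⟩ := mem_hexSlots.1 hs
    rw [hT, mem_image]
    refine ⟨(i, y', z'), mem_product.2 ⟨mem_filter.2 ⟨mem_range.2 (by omega), h1.symm⟩,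
      mem_biUnion.2 ⟨y', mem_hexNb'.2 h2, mem_image.2 ⟨z', mem_hexNb'.2 h3, rfl⟩⟩⟩, rfl⟩
  refine (card_le_card hsub).trans (card_image_le.trans ?_)
  rw [card_product]
  have hP3 : #P ≤ 3 := card_filter_getD_adj_le' hω t
  have h9 : #((hexNb t).biUnion fun y' => (hexNb y').image fun z' => (y', z')) ≤ 9 := by
    refine card_biUnion_le.trans ?_
    calc ∑ y' ∈ hexNb t, #((hexNb y').image fun z' => (y', z')) ≤ ∑ _y' ∈ hexNb t, 3 :=
          sum_le_sum fun y' _ => card_image_le.trans (card_hexNb_le' y')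
      _ ≤ 9 := by rw [sum_const, smul_eq_mul]; have := card_hexNb_le' t; omega
  calc #P * #((hexNb t).biUnion fun y' => (hexNb y').image fun z' => (y', z')) ≤ 3 * 9 :=
        Nat.mul_le_mul hP3 h9
    _ = 27 := by norm_num

/-- Slots whose middle new vertex is `t`: at most `27`. [folklore] -/
private theorem card_hexSlots_filter_y_eq_le' (hω : ω ∈ sawFin hvOrigin N) (t : HV) :
    #((hexSlots ω).filter fun s => s.2.2.1 = t) ≤ 27 := by
  have hl := length_of_mem_sawFin hω
  set P : HV → Finset ℕ := fun x' => (range (N + 1)).filter fun i => hvGraph.Adj x' (ω.getD i hvOrigin) with hP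
  set T := (((hexNb t).biUnion fun x' => (P x').image fun i => (i, x')) ×ˢ hexNb t).image
    fun q : (ℕ × HV) × HV => (q.1.1, q.1.2, t, q.2) with hT
  have hsub : ((hexSlots ω).filter fun s => s.2.2.1 = t) ⊆ T := by
    rintro ⟨i, x', y', z'⟩ hs
    rw [mem_filter] at hs
    obtain ⟨hs, rfl⟩ := hs
    obtain ⟨hi, h1, h2, h3, -⟩ := mem_hexSlots.1 hs
    rw [hT, mem_image]
    refine ⟨((i, x'), z'), mem_product.2 ⟨mem_biUnion.2 ⟨x', mem_hexNb'.2 h2.symm,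
      mem_image.2 ⟨i, mem_filter.2 ⟨mem_range.2 (by omega), h1.symm⟩, rfl⟩⟩, mem_hexNb'.2 h3⟩, rfl⟩
  refine (card_le_card hsub).trans (card_image_le.trans ?_)
  rw [card_product]
  have h9 : #((hexNb t).biUnion fun x' => (P x').image fun i => (i, x')) ≤ 9 := by
    refine card_biUnion_le.trans ?_
    calc ∑ x' ∈ hexNb t, #((P x').image fun i => (i, x')) ≤ ∑ _x' ∈ hexNb t, 3 :=
          sum_le_sum fun x' _ => card_image_le.trans (card_filter_getD_adj_le' hω x')
      _ ≤ 9 := by rw [sum_const, smul_eq_mul]; have := card_hexNb_le' t; omega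
  calc #((hexNb t).biUnion fun x' => (P x').image fun i => (i, x')) * #(hexNb t) ≤ 9 * 3 :=
        Nat.mul_le_mul h9 (card_hexNb_le' t)
    _ = 27 := by norm_num

/-- Slots whose last new vertex is `t`: at most `27`. [folklore] -/
private theorem card_hexSlots_filter_z_eq_le' (hω : ω ∈ sawFin hvOrigin N) (t : HV) :
    #((hexSlots ω).filter fun s => s.2.2.2 = t) ≤ 27 := by
  have hl := length_of_mem_sawFin hω
  set P : HV → Finset ℕ := fun x' => (range (N + 1)).filter fun i => hvGraph.Adj x' (ω.getD i hvOrigin) with hP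
  set T := ((hexNb t).biUnion fun y' => (hexNb y').biUnion fun x' => (P x').image fun i => (i, x', y', t))
    with hT
  have hsub : ((hexSlots ω).filter fun s => s.2.2.2 = t) ⊆ T := by
    rintro ⟨i, x', y', z'⟩ hs
    rw [mem_filter] at hs
    obtain ⟨hs, rfl⟩ := hs
    obtain ⟨hi, h1, h2, h3, -⟩ := mem_hexSlots.1 hs
    rw [hT]
    exact mem_biUnion.2 ⟨y', mem_hexNb'.2 h3.symm, mem_biUnion.2 ⟨x', mem_hexNb'.2 h2.symm,
      mem_image.2 ⟨i, mem_filter.2 ⟨mem_range.2 (by omega), h1.symm⟩, rfl⟩⟩⟩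
  refine (card_le_card hsub).trans (card_biUnion_le.trans ?_)
  calc ∑ y' ∈ hexNb t, #((hexNb y').biUnion fun x' => (P x').image fun i => (i, x', y', t))
      ≤ ∑ _y' ∈ hexNb t, 9 := by
        refine sum_le_sum fun y' _ => card_biUnion_le.trans ?_
        calc ∑ x' ∈ hexNb y', #((P x').image fun i => (i, x', y', t)) ≤ ∑ _x' ∈ hexNb y', 3 :=
              sum_le_sum fun x' _ => card_image_le.trans (card_filter_getD_adj_le' hω x')
          _ ≤ 9 := by rw [sum_const, smul_eq_mul]; have := card_hexNb_le' y'; omega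
    _ ≤ 27 := by rw [sum_const, smul_eq_mul]; have := card_hexNb_le' t; omega

/-- Slots through a fixed vertex: at most `81`. [folklore] -/
private theorem card_hexSlots_filter_mem_le' (hω : ω ∈ sawFin hvOrigin N) (t : HV) :
    #((hexSlots ω).filter fun s => s.2.1 = t ∨ s.2.2.1 = t ∨ s.2.2.2 = t) ≤ 81 := by
  rw [filter_or, filter_or]
  have h1 := card_hexSlots_filter_x_eq_le' hω t
  have h2 := card_hexSlots_filter_y_eq_le' hω t
  have h3 := card_hexSlots_filter_z_eq_le' hω t
  have h4 := card_union_le ((hexSlots ω).filter fun s => s.2.2.1 = t) ((hexSlots ω).filter fun s => s.2.2.2 = t)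
  have h5 := card_union_le ((hexSlots ω).filter fun s => s.2.1 = t)
    (((hexSlots ω).filter fun s => s.2.2.1 = t) ∪ ((hexSlots ω).filter fun s => s.2.2.2 = t))
  omega


/-- **`J ≤ J_H + 3` on half-space walks**: a deletion site `(m, v)` with `m ≥ 1` frees a vertex strictly above the
base (it has the height of one of `ω_m, …, ω_{m+4}`, all above the base — `HexSAWHexagonHeights`); only the run
through `ω_0` (`m = 0`, at most three sites) can free a vertex at the base height.
[cite: MadrasSlade1993, §7.3, proof of Theorem 7.3.2, p. 245 (surgery inside a sub-class W_N; the half-space class is our analogue)] -/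
theorem card_hexSharp_le_card_hexSharpH_add_three (hω : ω ∈ hexHalfFin N) :
    #(hexSharp ω) ≤ #(hexSharpH ω) + 3 := by
  obtain ⟨hω', habove⟩ := mem_hexHalfFin.1 hω
  have hl := length_of_mem_sawFin hω'
  have hsub : hexSharp ω ⊆ hexSharpH ω ∪ (hexSharp ω).filter fun p => p.1 = 0 := by
    rintro ⟨j, v⟩ hp
    rw [mem_union, mem_filter]
    rcases Nat.eq_zero_or_pos j with h0 | hpos
    · exact Or.inr ⟨hp, h0⟩
    · left
      refine mem_hexSharpH.2 ⟨hp, ?_⟩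
      obtain ⟨hj, -, -, -⟩ := mem_hexSharp.1 hp
      exact hvToBW_zero_mem_of_mem_hexSharp (S := Set.Ioi (hvToBW (ω.getD 0 hvOrigin) 0)) hω' hp
        fun i hi1 hi2 => habove i (by omega) (by omega)
  calc #(hexSharp ω) ≤ #(hexSharpH ω ∪ (hexSharp ω).filter fun p => p.1 = 0) := card_le_card hsub
    _ ≤ #(hexSharpH ω) + #((hexSharp ω).filter fun p => p.1 = 0) := card_union_le _ _
    _ ≤ #(hexSharpH ω) + 3 := Nat.add_le_add_left (card_hexSharp_filter_fst_eq_le' ω 0) _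

/-- After an admissible insertion the new half-space walk has a counted deletion site: `1 ≤ J_H(ω')`.
[cite: MadrasSlade1993, §7.3 (proof of Theorem 7.3.2)] -/
theorem one_le_card_hexSharpH_hexIns (hω : ω ∈ hexHalfFin N) (hs : (m, x, y, z) ∈ hexSlotsH ω) :
    1 ≤ #(hexSharpH (hexIns m x y z ω)) :=
  card_pos.2 ⟨_, mem_hexSharpH_hexIns hω hs⟩

/-- `J_H(ω) ≤ J_H(ω') + 27` (`J_H ≤ J ≤ J' + 24 ≤ J_H' + 27`). [cite: MadrasSlade1993, §7.3 (proof of Theorem 7.3.2), p. 245] -/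
theorem card_hexSharpH_le_hexIns (hω : ω ∈ hexHalfFin N) (hs : (m, x, y, z) ∈ hexSlotsH ω) :
    #(hexSharpH ω) ≤ #(hexSharpH (hexIns m x y z ω)) + 27 := by
  have hω' := mem_sawFin_of_mem_hexHalfFin hω
  have hs' := hexSlotsH_subset hs
  have h1 : #(hexSharpH ω) ≤ #(hexSharp ω) := card_le_card hexSharpH_subset
  have h2 := card_hexSharp_le_hexIns hω' hs'
  have h3 := card_hexSharp_le_card_hexSharpH_add_three (hexIns_mem_hexHalfFin hω hs)
  omega

/-- `J_H(ω') ≤ J_H(ω) + 27` (`J_H' ≤ J' ≤ J + 24 ≤ J_H + 27`). [cite: MadrasSlade1993, §7.3 (proof of Theorem 7.3.2), p. 245] -/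
theorem card_hexSharpH_hexIns_le (hω : ω ∈ hexHalfFin N) (hs : (m, x, y, z) ∈ hexSlotsH ω) :
    #(hexSharpH (hexIns m x y z ω)) ≤ #(hexSharpH ω) + 27 := by
  have hω' := mem_sawFin_of_mem_hexHalfFin hω
  have hs' := hexSlotsH_subset hs
  have h1 : #(hexSharpH (hexIns m x y z ω)) ≤ #(hexSharp (hexIns m x y z ω)) := card_le_card hexSharpH_subset
  have h2 := card_hexSharp_hexIns_le hω' hs'
  have h3 := card_hexSharp_le_card_hexSharpH_add_three hω
  omega

/-- **`I_H(ω) ≤ I_H(ω') + 324`**: an admissible slot `(j, x', y', z')` of `ω` with `j ∉ {m−1, m, m+1}` and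
`{x', y', z'}` disjoint from `{x, y, z}` is (shifted by `2` if `j ≥ m + 2`) an admissible slot of
`hexIns m x y z ω` (same new vertices, same base). [cite: MadrasSlade1993, §7.3 (proof of Theorem 7.3.2), p. 245] -/
theorem card_hexSlotsH_le_hexIns (hω : ω ∈ hexHalfFin N) (hs : (m, x, y, z) ∈ hexSlotsH ω) :
    #(hexSlotsH ω) ≤ #(hexSlotsH (hexIns m x y z ω)) + 324 := by
  have hω' := mem_sawFin_of_mem_hexHalfFin hω
  have hs' := hexSlotsH_subset hs
  obtain ⟨hm, -, -, -, -, hxω, hyω, hzω, -⟩ := mem_hexSlots.1 hs'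
  have hl := length_of_mem_sawFin hω'
  let bad : ℕ × HV × HV × HV → Prop := fun s => (m ≤ s.1 + 1 ∧ s.1 ≤ m + 1) ∨
    ((s.2.1 = x ∨ s.2.2.1 = x ∨ s.2.2.2 = x) ∨ (s.2.1 = y ∨ s.2.2.1 = y ∨ s.2.2.2 = y) ∨
      (s.2.1 = z ∨ s.2.2.1 = z ∨ s.2.2.2 = z))
  set E := (hexSlotsH ω).filter fun s => bad s with hE
  set K := (hexSlotsH ω).filter fun s => ¬ bad s with hK
  have hsplit : #(hexSlotsH ω) = #E + #K := (card_filter_add_card_filter_not _).symm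
  have hE' : #E ≤ 324 := by
    have hsub : E ⊆ ((hexSlots ω).filter fun s => m - 1 ≤ s.1 ∧ s.1 ≤ m + 1) ∪
        (((hexSlots ω).filter fun s => s.2.1 = x ∨ s.2.2.1 = x ∨ s.2.2.2 = x) ∪
          (((hexSlots ω).filter fun s => s.2.1 = y ∨ s.2.2.1 = y ∨ s.2.2.2 = y) ∪
            ((hexSlots ω).filter fun s => s.2.1 = z ∨ s.2.2.1 = z ∨ s.2.2.2 = z))) := by
      intro p hp
      rw [hE, mem_filter] at hp
      have hp1 : p ∈ hexSlots ω := hexSlotsH_subset hp.1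
      simp only [mem_union, mem_filter]
      rcases hp.2 with h | h | h | h
      · exact Or.inl ⟨hp1, by omega, h.2⟩
      · exact Or.inr (Or.inl ⟨hp1, h⟩)
      · exact Or.inr (Or.inr (Or.inl ⟨hp1, h⟩))
      · exact Or.inr (Or.inr (Or.inr ⟨hp1, h⟩))
    refine (card_le_card hsub).trans ((card_union_le _ _).trans ?_)
    have h1 := card_hexSlots_filter_fst_mem_Icc_le' ω (m - 1) (m + 1)
    have h2 := card_hexSlots_filter_mem_le' hω' x
    have h3 := card_hexSlots_filter_mem_le' hω' y
    have h4 := card_hexSlots_filter_mem_le' hω' z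
    have h5 := card_union_le ((hexSlots ω).filter fun s => s.2.1 = x ∨ s.2.2.1 = x ∨ s.2.2.2 = x)
      (((hexSlots ω).filter fun s => s.2.1 = y ∨ s.2.2.1 = y ∨ s.2.2.2 = y) ∪
        ((hexSlots ω).filter fun s => s.2.1 = z ∨ s.2.2.1 = z ∨ s.2.2.2 = z))
    have h6 := card_union_le ((hexSlots ω).filter fun s => s.2.1 = y ∨ s.2.2.1 = y ∨ s.2.2.2 = y)
      ((hexSlots ω).filter fun s => s.2.1 = z ∨ s.2.2.1 = z ∨ s.2.2.2 = z)
    omega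
  have hK' : #K ≤ #(hexSlotsH (hexIns m x y z ω)) := by
    refine card_le_card_of_injOn (fun s => (if s.1 + 2 ≤ m then s.1 else s.1 + 2, s.2)) ?_ ?_
    · rintro ⟨j, x', y', z'⟩ hp
      rw [mem_coe, hK, mem_filter] at hp
      obtain ⟨hp, hne⟩ := hp
      obtain ⟨hp0, hax, hay, haz⟩ := mem_hexSlotsH.1 hp
      simp only [bad, not_or] at hne
      obtain ⟨hne1, ⟨hx1, hx2, hx3⟩, ⟨hy1, hy2, hy3⟩, ⟨hz1, hz2, hz3⟩⟩ := hne
      obtain ⟨hj, ha1, ha2, ha3, ha4, hx', hy', hz', hxz'⟩ := mem_hexSlots.1 hp0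
      have hnot : ∀ {a : HV}, a ∉ ω → a ≠ x → a ≠ y → a ≠ z → a ∉ hexIns m x y z ω :=
        fun ha hax hay haz h => by
          rcases mem_hexIns h with e | e | e | e
          · exact hax e
          · exact hay e
          · exact haz e
          · exact ha e
      have hA : ∀ {a : HV}, Above ω a → Above (hexIns m x y z ω) a := fun h => (above_hexIns_iff hm).2 h
      rw [mem_coe]
      dsimp only
      split_ifs with hjm
      · refine mem_hexSlotsH.2 ⟨mem_hexSlots.2 ⟨by rw [length_hexIns (by omega)]; omega, ?_, ha2, ha3, ?_,
          hnot hx' hx1 hy1 hz1, hnot hy' hx2 hy2 hz2, hnot hz' hx3 hy3 hz3, hxz'⟩, hA hax, hA hay, hA haz⟩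
        · rwa [getD_hexIns_of_le (by omega) (by omega)]
        · rwa [getD_hexIns_of_le (by omega) hjm]
      · have hj2 : m + 2 ≤ j := by omega
        refine mem_hexSlotsH.2 ⟨mem_hexSlots.2 ⟨by rw [length_hexIns (by omega)]; omega, ?_, ha2, ha3, ?_,
          hnot hx' hx1 hy1 hz1, hnot hy' hx2 hy2 hz2, hnot hz' hx3 hy3 hz3, hxz'⟩, hA hax, hA hay, hA haz⟩
        · rwa [getD_hexIns_of_ge (by omega) (by omega), show j + 2 - 2 = j by omega]
        · rwa [getD_hexIns_of_ge (by omega) (by omega), show j + 2 + 2 - 2 = j + 2 by omega]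
    · rintro ⟨j, c⟩ - ⟨j', c'⟩ - e
      simp only [Prod.mk.injEq] at e
      obtain ⟨e1, rfl⟩ := e
      have : j = j' := by split_ifs at e1 <;> omega
      rw [this]
  omega

end Bookkeeping

end Literature.Probability.RandomPlanarGeometry.SAW.HV
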